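import Summits.QuantumFields.YangMills.Theorems.UV3PinnedStepOfPackageV3
import Summits.QuantumFields.YangMills.Theorems.AlphaInputsT3ACv3Pint
import HarnessLib

/-!
# R3 (cell `ym3-torus`, YM₃ on T³ — a ladder RUNG, NOT d = 4, NOT the Clay problem), UV3-node side of `stub_pinnedStep` (R-19936-S), v3 currency —
# **(S-KNIT) OVER THE v3 SOCKET: the `Ecst`-anchored pure-pin (41) at the unit lattice (`hPinA` of ✓`UV3PinnedStepV3FaceOfPackageV3`) FROM ROW (S-i)
# (✓`UV3PinnedStepOfPackageV3`, kernel, modulo the v3 rows) AND ONE DISPLAYED ROW (S-ii)ᵥ₃ over the RESTRICTED SUM of the WINDOWED pinned weights `wtP`**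

Seat `ym3-torus-px8` g11.  THEOREMS ONLY (0 `def`, 0 `sorry`); `--supports stmt-QuantumFields-19936 --as helper`; count-neutral.  The v3 twin of ✓p750864 `UV3PinnedStepKnitOfPackage`
(★★OWNER WORD 58 (e); the v3 reading — `wtP = 𝟙[win]·massP`, `∫ massP ≤ 1`, no floor — is the residual hJ's honest home).  INPUTS BY NAME: ✓`AlphaInputsT3AC.PkgCoreV3.
resDensity_pinned_le_sum_ae` at `(h.pkgAtV3 …).toCore`, (46) at the top level for every history `PkgAtV3.abs_Pint_succ_le` + `card_lamFin_le_sitesPerDir_cube` (px12 g12's K-uniform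
`Pint_K ≤ CP` derivation of ✓`UV3UnitEnvelopeFaceOfPackageV3`, verbatim), `e^{Rm_K} ≤ CRm` (lit `T3AlphaInputsAC.exp_two_Rm_le`∕`Rm_nonneg` on ✓`dataT3v3_rmSize`), `PkgAtV3.eps1_eq`.
DISPLAYED: row (S-ii)ᵥ₃ — `∀ᵐ W` (★★OWNER RULING №32; R526 hand w6 g7's letter note), the restricted sum of the v3 package's windowed pinned weights over «`a ∈ P_j(h)` ∨ collar» weighted
by `e^{−mainT_K + Zterm_K}` at most `e^{CZ}·β_{K−j}^A·e^{−c·p_𝔠(g_{K−j})²}` — R-19936-S's organ in v3 currency (⟸ w6 g7's T-rows + hJ), NOT proved here.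

WHAT IS PROVED (ns `…Theorems.UV3PinnedStepKnitOfPackageV3`):
* §1 ★★★ `AlphaInputsT3AC.OfV3At.pinnedTop_of_pinnedLF` — per family∕record∕socket∕coupling∕depth: (S-ii)ᵥ₃ ⟹ the `Ecst`-anchored pure-pin bound with `Cu := CP + CZ + log CRm`.
* §2 ★★★ `hPinA_of_pinnedLF_v3` — the `hPinA` letter of ✓`UV3PinnedStepV3FaceOfPackageV3.stub_pinnedStepV3_of_packageV3_of_purePinTop` (binder text VERBATIM) from the
  same-prefixed (S-ii)ᵥ₃ row.

HONEST SCOPE.  Bookkeeping; CONDITIONAL on the v3 socket and on (S-ii)ᵥ₃; nothing of (S-ii)ᵥ₃, hJ, `stub_pinnedStep`, `hP′`, `HistoryTailL` (19936) proved; nothing continuum ∕ OS ∕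
mass-gap ∕ Clay.
References: T. Bałaban, CMP **102** (1985) 255–275 [Balaban1985UV3] ((7) p. 257, (40)–(41) p. 266, (46) p. 267, (64) p. 273, (67)–(71) pp. 273–274).
-/

set_option autoImplicit false

noncomputable section

namespace Summit.QuantumFields.YangMills.Theorems.UV3PinnedStepKnitOfPackageV3

open MeasureTheory
open Literature.MathematicalPhysics.QuantumFieldTheory.Balaban1983to89
open Literature.MathematicalPhysics.QuantumFieldTheory.Balaban1983to89.T3ContinuumYM3Torus
open Literature.MathematicalPhysics.QuantumFieldTheory.Balaban1983to89.T3UnitLawDensityEML (ℰp)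
open Literature.MathematicalPhysics.QuantumFieldTheory.Balaban1983to89.T3UnitScaleTilt (θBal)
open Literature.MathematicalPhysics.QuantumFieldTheory.Balaban1983to89.T3RestrictedUnitDensity (resDensity)
open Literature.MathematicalPhysics.QuantumFieldTheory.Balaban1983to89.T3AlphaInputsAC
open Literature.MathematicalPhysics.QuantumFieldTheory.Balaban1985CMP102
open Literature.MathematicalPhysics.QuantumFieldTheory.Balaban1985CMP102.Setting
open Summit.QuantumFields.Balaban3D.Carriers
open Summit.QuantumFields.Balaban3D.Proofs.Primitives
open Summit.QuantumFields.Balaban3D.Proofs.TowerAC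
open Summit.QuantumFields.Balaban3D.Proofs.StandardAC
open Summit.QuantumFields.Balaban3D.Proofs.Inputs
open Summit.QuantumFields.Balaban3D.Proofs.InputsAC

variable {F : T3Family} {𝔠 : AlphaConsts F.L (suGroupModel 2).N} {a₀ a₁ : ℝ}

/-! ## §1 Per family: the anchored pure-pin (41) at the unit lattice from (S-i)ᵥ₃ and the displayed (S-ii)ᵥ₃ -/

open Classical in
/-- ★★★ **THE `Ecst`-ANCHORED PURE-PIN (41) AT THE UNIT LATTICE OVER THE v3 SOCKET, PER FAMILY, FROM ROW (S-i) AND THE DISPLAYED ROW (S-ii)ᵥ₃.**  Socket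
`h : OfV3At F 𝔠 a₀ a₁` with `hc`, coupling in the window, polymer fields `π`, depth `m`; (S-ii)ᵥ₃ `hSii`: constants `CZ, c > 0, A` with, at the constrained heights and every
level-`j` plaquette `a`, `dV_K`-a.e. in `W`, the RESTRICTED sum of the v3 package's windowed pinned weights `(h.pkgAtV3 hc γ hγ hγ1 K).wtP K r W` over «`a ∈ r(j)` ∨
`¬ plaqCover a ⊆ Ω_j(r↾j)`» weighted by `exp(−mainT_K + Zterm_K)` at most `exp CZ·(β_{K−j}^A·exp(−(c·pFun 𝔠.b₀ 𝔠.p₀ (g_{K−j}))²))`.  THEN `∃ Cu c A, 0 < c ∧` at the same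
heights∕plaquettes, `dV_K`-a.e., `ρ^{Pin(K,j,a)}_K ≤ exp(−(h.dataT3v3 …).Ecst K K + Cu)·(β_{K−j}^A·exp(−(c·pFun 𝔠.b₀ 𝔠.p₀ (g_{K−j}))²))`.
[cite: Balaban1985UV3, (40)-(41) p.266 + (46) p.267 + (64) p.273 + (67)-(71) pp.273-274] -/
theorem _root_.Summit.QuantumFields.YangMills.Theorems.AlphaInputsT3AC.OfV3At.pinnedTop_of_pinnedLF (h : AlphaInputsT3AC.OfV3At F 𝔠 a₀ a₁)
    (hc : 0 < a₀ ∧ 0 < a₁ ∧ 𝔠.B₃ * a₁ ≤ a₀) (γ : ℝ) (hγ : 0 < γ) (hγ1 : γ ≤ (min 𝔠.gamma0 1) ^ 2) (π : AlphaInputsT3AC.PolymerT3 F) (m : ℕ)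
    (hSii : ∃ (CZ c : ℝ) (A : ℕ), 0 < c ∧
      ∀ (K j : ℕ) (hj1 : 1 ≤ j) (hjK : j + 2 ≤ K), j + (K - 1) / m ≤ K → ∀ (a : Plaq (F.P K) j),
        ∀ᵐ W ∂(fieldMeasure (F.P K) K (Matrix.specialUnitaryGroup (Fin 2) ℂ)),
        ∑ r ∈ Finset.univ.filter (fun r : Hist (F.P K) K =>
            a ∈ r ⟨j, by omega⟩ ∨ ¬ plaqCover a ⊆ Omega 𝔠.lane.carrier.M₁
              (rcolOf (T3Scales F γ hγ (hγ1.trans (sq_min_one_le _ 𝔠.gamma0_pos)) K) 𝔠.lane.carrier) j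
              (fun i : Fin j => r (Fin.castLE (by omega) i)) j),
          (h.pkgAtV3 hc γ hγ hγ1 K).wtP K r W *
            Real.exp (-((h.pkgAtV3 hc γ hγ hγ1 K).T.mainT K r W) + (h.pkgAtV3 hc γ hγ hγ1 K).T.Zterm K r) ≤
        Real.exp CZ * ((F.scheme ℰp γ).β (K - j) ^ A *
          Real.exp (-(c * B10.pFun 𝔠.b₀ 𝔠.p₀ (Real.sqrt (γ * ((F.L : ℝ)⁻¹) ^ (K - j))) ^ 2)))) :
    ∃ (Cu c : ℝ) (A : ℕ), 0 < c ∧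
      ∀ (K j : ℕ), 1 ≤ j → j + 2 ≤ K → j + (K - 1) / m ≤ K → ∀ (a : Plaq (F.P K) j),
        ∀ᵐ V ∂(fieldMeasure (F.P K) K (Matrix.specialUnitaryGroup (Fin 2) ℂ)),
          resDensity F γ K
            {U : GaugeField (F.P K) 0 (Matrix.specialUnitaryGroup (Fin 2) ℂ) |
              θBal F.L γ 𝔠.b₀ 𝔠.p₀ (K - j) ≤ GaugeGroup.dist1 (GaugeField.plaqHol
                (Averaging.iter (fun i' => BlockAveraging.blockAvg (P := F.P K) (j := i') ℰp) j U) a)}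
            K V ≤
          Real.exp (-((h.dataT3v3 hc γ hγ hγ1 π).Ecst K K) + Cu) *
            ((F.scheme ℰp γ).β (K - j) ^ A *
              Real.exp (-(c * B10.pFun 𝔠.b₀ 𝔠.p₀ (Real.sqrt (γ * ((F.L : ℝ)⁻¹) ^ (K - j))) ^ 2))) := by
  obtain ⟨CZ, c, A, hcpos, hS⟩ := hSii
  obtain ⟨CRm, hCRm⟩ := exp_two_Rm_le (h.dataT3v3_rmSize hc γ hγ hγ1 π)
  have hCRm_pos : 0 < CRm := lt_of_lt_of_le (Real.exp_pos _) (hCRm 0 0 le_rfl)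
  set CP : ℝ := 𝔠.C46 * (𝔠.M₁ : ℝ) ^ 3 * θBal F.L γ 𝔠.b₀ 𝔠.p₀ 1 ^ 2 * ((2 * F.L ^ F.m : ℕ) : ℝ) ^ 3 with hCPdef
  -- (46) at the top level, every history, K-uniform (px12 g12's derivation)
  have hPint : ∀ (K : ℕ), 1 ≤ K → ∀ (r : Hist (F.P K) K) (W : GaugeField (F.P K) K (Matrix.specialUnitaryGroup (Fin 2) ℂ)),
      (h.pkgAtV3 hc γ hγ hγ1 K).T.Pint K r W ≤ CP := by
    intro K hK r W
    obtain ⟨k, rfl⟩ : ∃ k, K = k + 1 := ⟨K - 1, by omega⟩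
    have h46 := (h.pkgAtV3 hc γ hγ hγ1 (k + 1)).abs_Pint_succ_le k le_rfl r W
    have hvol := card_lamFin_le_sitesPerDir_cube (F := F) (K := k + 1) 𝔠.lane.carrier.M₁
      (rcolOf (T3Scales F γ hγ (hγ1.trans (sq_min_one_le _ 𝔠.gamma0_pos)) (k + 1)) 𝔠.lane.carrier) k r
    have hsites : ((F.P (k + 1)).sitesPerDir (k + 1) : ℝ) = ((2 * F.L ^ F.m : ℕ) : ℝ) := by
      have : (F.P (k + 1)).sitesPerDir (k + 1) = 2 * F.L ^ F.m := by simp [Params.sitesPerDir]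
      rw [this]
    have hk : k + 1 - k = 1 := by omega
    rw [hk] at h46
    rw [hsites] at hvol
    have hC : 0 ≤ 𝔠.C46 * (𝔠.M₁ : ℝ) ^ 3 * θBal F.L γ 𝔠.b₀ 𝔠.p₀ 1 ^ 2 :=
      mul_nonneg (mul_nonneg 𝔠.C46_nonneg (pow_nonneg (Nat.cast_nonneg _) _)) (sq_nonneg _)
    have hle := (abs_le.mp h46).2
    calc (h.pkgAtV3 hc γ hγ hγ1 (k + 1)).T.Pint (k + 1) r W
        ≤ 𝔠.C46 * (𝔠.M₁ : ℝ) ^ 3 * θBal F.L γ 𝔠.b₀ 𝔠.p₀ 1 ^ 2 *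
            ((LamFin 𝔠.lane.carrier.M₁
              (rcolOf (T3Scales F γ hγ (hγ1.trans (sq_min_one_le _ 𝔠.gamma0_pos)) (k + 1)) 𝔠.lane.carrier) k r).card : ℝ) := hle
      _ ≤ CP := mul_le_mul_of_nonneg_left hvol hC
  refine ⟨CP + CZ + Real.log CRm, c, A, hcpos, fun K j hj1 hjK hjm a => ?_⟩
  set p := h.pkgAtV3 hc γ hγ hγ1 K with hp
  have hθ : eps1Of (T3Scales F γ hγ (hγ1.trans (sq_min_one_le _ 𝔠.gamma0_pos)) K) 𝔠.lane.carrier j ≤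
      θBal F.L γ 𝔠.b₀ 𝔠.p₀ (K - j) := le_of_eq (p.eps1_eq j (by omega))
  -- row (S-i) over the core of the package's data, at the unit lattice
  have hSi := p.toCore.resDensity_pinned_le_sum_ae j (by omega) a (θBal F.L γ 𝔠.b₀ 𝔠.p₀ (K - j)) hθ K (by omega) le_rfl
  -- `Rm_K ≥ 0`, `e^{Rm_K} ≤ CRm`
  have hRm0 : 0 ≤ p.T.Rm K := Rm_nonneg (h.dataT3v3_rmSize hc γ hγ hγ1 π) (le_refl K)
  have hRm : Real.exp (p.T.Rm K) ≤ CRm := by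
    have h2 := hCRm K K le_rfl
    have hle : Real.exp (p.T.Rm K) ≤ Real.exp (2 * (h.dataT3v3 hc γ hγ hγ1 π).Rm K K) := by
      apply Real.exp_le_exp.mpr
      show p.T.Rm K ≤ 2 * p.T.Rm K
      linarith
    exact hle.trans h2
  have hSKj := hS K j hj1 hjK hjm a
  filter_upwards [hSi, hSKj] with W hW hSW
  refine hW.trans ?_
  set Sf := Finset.univ.filter (fun r : Hist (F.P K) K =>
      a ∈ r ⟨j, by omega⟩ ∨ ¬ plaqCover a ⊆ Omega 𝔠.lane.carrier.M₁
        (rcolOf (T3Scales F γ hγ (hγ1.trans (sq_min_one_le _ 𝔠.gamma0_pos)) K) 𝔠.lane.carrier) j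
        (fun i : Fin j => r (Fin.castLE (by omega) i)) j) with hSf
  have hw0 : ∀ r W, 0 ≤ p.wtP K r W := fun r W =>
    (PinnedStep.wtP_nonneg_le 𝔠.lane p.X (AlphaInputsT3AC.admWindowT3 F 𝔠 γ hγ hγ1 K) K r W).1
  have hterm : ∀ r ∈ Sf, p.wtP K r W *
        Real.exp (-(p.T.mainT K r W) + p.T.Pint K r W - p.T.Ecst K + p.T.Zterm K r + p.T.Rm K) ≤
      Real.exp (CP - p.T.Ecst K + p.T.Rm K) * (p.wtP K r W * Real.exp (-(p.T.mainT K r W) + p.T.Zterm K r)) := by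
    intro r _
    have hexp : Real.exp (-(p.T.mainT K r W) + p.T.Pint K r W - p.T.Ecst K + p.T.Zterm K r + p.T.Rm K) ≤
        Real.exp (CP - p.T.Ecst K + p.T.Rm K) * Real.exp (-(p.T.mainT K r W) + p.T.Zterm K r) := by
      rw [← Real.exp_add]
      exact Real.exp_le_exp.mpr (by linarith [hPint K (by omega) r W])
    calc p.wtP K r W * Real.exp (-(p.T.mainT K r W) + p.T.Pint K r W - p.T.Ecst K + p.T.Zterm K r + p.T.Rm K)
        ≤ p.wtP K r W * (Real.exp (CP - p.T.Ecst K + p.T.Rm K) * Real.exp (-(p.T.mainT K r W) + p.T.Zterm K r)) :=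
          mul_le_mul_of_nonneg_left hexp (hw0 r W)
      _ = _ := by ring
  have hsum := Finset.sum_le_sum hterm
  rw [← Finset.mul_sum] at hsum
  have hrate : 0 ≤ (F.scheme ℰp γ).β (K - j) ^ A *
      Real.exp (-(c * B10.pFun 𝔠.b₀ 𝔠.p₀ (Real.sqrt (γ * ((F.L : ℝ)⁻¹) ^ (K - j))) ^ 2)) :=
    mul_nonneg (pow_nonneg (F.scheme_β_nonneg ℰp hγ.le (K - j)) A) (Real.exp_nonneg _)
  have hEcst : (h.dataT3v3 hc γ hγ hγ1 π).Ecst K K = p.T.Ecst K - p.E := rfl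
  have hscal : Real.exp (-(p.T.Ecst K - p.E) + (CP + CZ)) * CRm =
      Real.exp (-((h.dataT3v3 hc γ hγ hγ1 π).Ecst K K) + (CP + CZ + Real.log CRm)) := by
    rw [hEcst, show -(p.T.Ecst K - p.E) + (CP + CZ + Real.log CRm) = (-(p.T.Ecst K - p.E) + (CP + CZ)) + Real.log CRm by ring,
      Real.exp_add (-(p.T.Ecst K - p.E) + (CP + CZ)) (Real.log CRm), Real.exp_log hCRm_pos]
  calc Real.exp p.toCore.E * ∑ r ∈ Sf, p.toCore.wtP K r W *
          Real.exp (-(p.toCore.T.mainT K r W) + p.toCore.T.Pint K r W - p.toCore.T.Ecst K + p.toCore.T.Zterm K r + p.toCore.T.Rm K)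
      = Real.exp p.E * ∑ r ∈ Sf, p.wtP K r W *
          Real.exp (-(p.T.mainT K r W) + p.T.Pint K r W - p.T.Ecst K + p.T.Zterm K r + p.T.Rm K) := rfl
    _ ≤ Real.exp p.E * (Real.exp (CP - p.T.Ecst K + p.T.Rm K) * ∑ r ∈ Sf, p.wtP K r W *
          Real.exp (-(p.T.mainT K r W) + p.T.Zterm K r)) := mul_le_mul_of_nonneg_left hsum (Real.exp_nonneg _)
    _ ≤ Real.exp p.E * (Real.exp (CP - p.T.Ecst K + p.T.Rm K) * (Real.exp CZ * ((F.scheme ℰp γ).β (K - j) ^ A *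
          Real.exp (-(c * B10.pFun 𝔠.b₀ 𝔠.p₀ (Real.sqrt (γ * ((F.L : ℝ)⁻¹) ^ (K - j))) ^ 2))))) :=
        mul_le_mul_of_nonneg_left (mul_le_mul_of_nonneg_left (by rw [hSf]; exact hSW) (Real.exp_nonneg _)) (Real.exp_nonneg _)
    _ = (Real.exp (-(p.T.Ecst K - p.E) + (CP + CZ)) * Real.exp (p.T.Rm K)) * ((F.scheme ℰp γ).β (K - j) ^ A *
          Real.exp (-(c * B10.pFun 𝔠.b₀ 𝔠.p₀ (Real.sqrt (γ * ((F.L : ℝ)⁻¹) ^ (K - j))) ^ 2))) := by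
        have : Real.exp p.E * (Real.exp (CP - p.T.Ecst K + p.T.Rm K) * Real.exp CZ) =
            Real.exp (-(p.T.Ecst K - p.E) + (CP + CZ)) * Real.exp (p.T.Rm K) := by
          rw [← Real.exp_add, ← Real.exp_add, ← Real.exp_add]; congr 1; ring
        rw [← this]; ring
    _ ≤ (Real.exp (-(p.T.Ecst K - p.E) + (CP + CZ)) * CRm) * ((F.scheme ℰp γ).β (K - j) ^ A *
          Real.exp (-(c * B10.pFun 𝔠.b₀ 𝔠.p₀ (Real.sqrt (γ * ((F.L : ℝ)⁻¹) ^ (K - j))) ^ 2))) :=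
        mul_le_mul_of_nonneg_right (mul_le_mul_of_nonneg_left hRm (Real.exp_nonneg _)) hrate
    _ = Real.exp (-((h.dataT3v3 hc γ hγ hγ1 π).Ecst K K) + (CP + CZ + Real.log CRm)) * ((F.scheme ℰp γ).β (K - j) ^ A *
          Real.exp (-(c * B10.pFun 𝔠.b₀ 𝔠.p₀ (Real.sqrt (γ * ((F.L : ℝ)⁻¹) ^ (K - j))) ^ 2))) := by rw [hscal]

/-! ## §2 The `hPinA` letter of the v3 S-face from the same-prefixed (S-ii)ᵥ₃ row -/

open Classical in
/-- ★★★ **`hPinA` OF ✓`UV3PinnedStepV3FaceOfPackageV3.stub_pinnedStepV3_of_packageV3_of_purePinTop` (binder text verbatim) FROM THE (S-ii)ᵥ₃ ROW WITH THE SAME PREFIX.**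
Per block size `L`, record `𝔠`, constants `a₀ a₁` with `hc`, sockets `hOf`; per depth `m` the (S-ii)ᵥ₃ row supplies `γ₁` and, per family∕coupling below it, the restricted-sum bound; §1
family by family (after `subst`). [cite: Balaban1985UV3, (40)-(41) p.266 + (46) p.267 + (64) p.273 + (67)-(71) pp.273-274] -/
theorem hPinA_of_pinnedLF_v3 (π : ∀ F : T3Family, AlphaInputsT3AC.PolymerT3 F)
    (hSii : ∀ (L : ℕ) (𝔠 : AlphaConsts L (suGroupModel 2).N) (a₀ a₁ : ℝ),
      (0 < a₀ ∧ 0 < a₁ ∧ 𝔠.B₃ * a₁ ≤ a₀) →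
      ∀ (hOf : ∀ (F : T3Family) (hF : F.L = L), AlphaInputsT3AC.OfV3At F (hF ▸ 𝔠) a₀ a₁),
        ∀ (m : ℕ), 0 < m →
          ∃ γ₁ : ℝ, 0 < γ₁ ∧ ∀ (F : T3Family) (hF : F.L = L)
            (hc' : 0 < a₀ ∧ 0 < a₁ ∧ (hF ▸ 𝔠).B₃ * a₁ ≤ a₀) (γ : ℝ) (hγ : 0 < γ) (hγ1' : γ ≤ (min (hF ▸ 𝔠).gamma0 1) ^ 2), γ ≤ γ₁ →
            ∃ (CZ c : ℝ) (A : ℕ), 0 < c ∧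
              ∀ (K j : ℕ) (hj1 : 1 ≤ j) (hjK : j + 2 ≤ K), j + (K - 1) / m ≤ K → ∀ (a : Plaq (F.P K) j),
                ∀ᵐ W ∂(fieldMeasure (F.P K) K (Matrix.specialUnitaryGroup (Fin 2) ℂ)),
                ∑ r ∈ Finset.univ.filter (fun r : Hist (F.P K) K =>
                    a ∈ r ⟨j, by omega⟩ ∨ ¬ plaqCover a ⊆ Omega (hF ▸ 𝔠).lane.carrier.M₁
                      (rcolOf (T3Scales F γ hγ (hγ1'.trans (sq_min_one_le _ (hF ▸ 𝔠).gamma0_pos)) K) (hF ▸ 𝔠).lane.carrier) j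
                      (fun i : Fin j => r (Fin.castLE (by omega) i)) j),
                  ((hOf F hF).pkgAtV3 hc' γ hγ hγ1' K).wtP K r W *
                    Real.exp (-(((hOf F hF).pkgAtV3 hc' γ hγ hγ1' K).T.mainT K r W) + ((hOf F hF).pkgAtV3 hc' γ hγ hγ1' K).T.Zterm K r) ≤
                Real.exp CZ * ((F.scheme ℰp γ).β (K - j) ^ A *
                  Real.exp (-(c * B10.pFun (hF ▸ 𝔠).b₀ (hF ▸ 𝔠).p₀ (Real.sqrt (γ * ((F.L : ℝ)⁻¹) ^ (K - j))) ^ 2)))) :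
    ∀ (L : ℕ) (𝔠 : AlphaConsts L (suGroupModel 2).N) (a₀ a₁ : ℝ),
      (0 < a₀ ∧ 0 < a₁ ∧ 𝔠.B₃ * a₁ ≤ a₀) →
      ∀ (hOf : ∀ (F : T3Family) (hF : F.L = L), AlphaInputsT3AC.OfV3At F (hF ▸ 𝔠) a₀ a₁),
        ∀ (m : ℕ), 0 < m →
          ∃ γ₁ : ℝ, 0 < γ₁ ∧ ∀ (F : T3Family) (hF : F.L = L)
            (hc' : 0 < a₀ ∧ 0 < a₁ ∧ (hF ▸ 𝔠).B₃ * a₁ ≤ a₀) (γ : ℝ) (hγ : 0 < γ) (hγ1' : γ ≤ (min (hF ▸ 𝔠).gamma0 1) ^ 2), γ ≤ γ₁ →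
            ∃ (Cu c : ℝ) (A : ℕ), 0 < c ∧
              ∀ (K j : ℕ), 1 ≤ j → j + 2 ≤ K → j + (K - 1) / m ≤ K → ∀ (a : Plaq (F.P K) j),
                ∀ᵐ V ∂(fieldMeasure (F.P K) K (Matrix.specialUnitaryGroup (Fin 2) ℂ)),
                  resDensity F γ K
                    {U : GaugeField (F.P K) 0 (Matrix.specialUnitaryGroup (Fin 2) ℂ) |
                      θBal F.L γ (hF ▸ 𝔠).b₀ (hF ▸ 𝔠).p₀ (K - j) ≤ GaugeGroup.dist1 (GaugeField.plaqHol
                        (Averaging.iter (fun i' => BlockAveraging.blockAvg (P := F.P K) (j := i') ℰp) j U) a)}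
                    K V ≤
                  Real.exp (-(((hOf F hF).dataT3v3 hc' γ hγ hγ1' (π F)).Ecst K K) + Cu) *
                    ((F.scheme ℰp γ).β (K - j) ^ A *
                      Real.exp (-(c * B10.pFun (hF ▸ 𝔠).b₀ (hF ▸ 𝔠).p₀ (Real.sqrt (γ * ((F.L : ℝ)⁻¹) ^ (K - j))) ^ 2))) := by
  intro L 𝔠 a₀ a₁ hc hOf m hm
  obtain ⟨γ₁, hγ₁, HF⟩ := hSii L 𝔠 a₀ a₁ hc hOf m hm
  refine ⟨γ₁, hγ₁, fun F hF hc' γ hγ hγ1' hγle => ?_⟩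
  subst hF
  exact (hOf F rfl).pinnedTop_of_pinnedLF hc' γ hγ hγ1' (π F) m (HF F rfl hc' γ hγ hγ1' hγle)

end Summit.QuantumFields.YangMills.Theorems.UV3PinnedStepKnitOfPackageV3

end
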